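import Mathlib
import HarnessLib
import Literature.Analysis.FluidPDE.BeltramiFlows
import Summits.NavierStokesRegularity.FluidComputer.ABCAlphaPointStrain
import Summits.NavierStokesRegularity.FluidComputer.ABCStagnationSkeleton

/-!
# The Jacobian of the ABC 1:1:1 host at its stagnation points: symmetric, NON-DEGENERATE (`(det ∇U)² = ½`),
# two types by the sign of `det ∇U`, strain rates `(±√2, ∓√2/2, ∓√2/2)`, four of each type per cell
# (instab lane, door O-acc = O7 / obstruction P3 — companion of `ABCStagnationSkeleton`; cell `ns-blowup`,
# seat `ns-blowup-instab2`)

HONEST FRAMING (human ruling D-0035): this cell ATTEMPTS the negative direction of the Clay problem; nothing in this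
file is a claim about the Navier–Stokes equations. WHAT THIS IS NOT: not dynamics — `3 × 3` linear algebra on the
Jacobian `J = Literature.Analysis.FluidPDE.ABC.jac 1 1 1 x` (row `j` = `∂/∂xⱼ`, column `i` = component) of the tree's
ABC field `U = abc 1 1 1`, at the points where `U x = 0`. `ABCStagnationSkeleton` (p434931) proved that the zero set
is EXACTLY the eight points `α₀…α₃, β₀…β₃ (mod 2πℤ³)` and the lattice lemma `sin² xᵢ = cos² xᵢ = ½` there; this file
reads off what that forces on `J`.

## Why the cell wants it
The site detector types every zero of a velocity field by `sign det ∇u` (α: `+`, β: `−`), checks completeness by the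
signed count `#α − #β = 0`, and on the generic arm its registered prior is «the 8 skeleton zeros are structurally
stable: displaced `O(ε)`, not destroyed, for `t ≲ t_rope`» (STATUS PRE-DATA NOTE 2026-08-26 (g1)/(g2)). Structural
stability = NON-DEGENERACY of `∇U` at each zero (implicit function theorem) — proved here uniformly; the P-TOWER
dictionary entry «the host strain at an α-point is the axisymmetric `diag(σ_α, −σ_α/2, −σ_α/2)`, `σ_α = √2`»
(`ABCAlphaPointStrain`, by evaluation at `α₀`) is proved here for ALL four α-points from the stagnation equations alone.

## What is proved (Mathlib + `BeltramiFlows` + `ABCAlphaPointStrain` + `ABCStagnationSkeleton`; no definitions)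
* §1 at a general point: `jac_apply`, `jac_trace` (`tr J = 0`), `jac_det_eq`
  (`det J = cos x₀ cos x₁ cos x₂ − sin x₀ sin x₁ sin x₂`), `jac_minors_eq` (second invariant
  `m₂ = cos x₀ sin x₁ + sin x₀ cos x₂ + cos x₁ sin x₂`), `jac_charpoly` (`det(J − λ) = −λ³ − m₂λ + det J`);
* §2 at a stagnation point (`U x = 0`): **`jac_symm_of_abc_eq_zero`** (`J` SYMMETRIC — pure strain, no rotation: the
  Beltrami host's vorticity `curl U = U` vanishes exactly where `U` does), `jac_eq_of_abc_eq_zero`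
  (`J = [[0,c₀,c₂],[c₀,0,c₁],[c₂,c₁,0]]`, `cᵢ = cos xᵢ`), `jac_det_eq_of_abc_eq_zero` (`det J = −2 sin x₀ sin x₁ sin x₂`)
  / `jac_det_eq_cos_of_abc_eq_zero` (`= 2 cos x₀ cos x₁ cos x₂`), **`jac_det_sq_of_abc_eq_zero` (`(det J)² = ½`: every
  stagnation point is NON-DEGENERATE)**, `jac_det_ne_zero_of_abc_eq_zero`, `jac_det_eq_or_of_abc_eq_zero`
  (`det J = ±√2/2`: two types and nothing else), the TYPE RULE `jac_det_pos_iff_of_abc_eq_zero`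
  (`det J > 0 ⇔ sin x₀ sin x₁ sin x₂ < 0`), `jac_minors_of_abc_eq_zero` (`m₂ = −3/2` at EVERY zero), hence
  **`jac_charpoly_of_abc_eq_zero`: `det(J − λ) = −λ³ + (3/2)λ + det J`** and its factorisations
  `charpoly_alpha_factor` / `jac_charpoly_alpha` (`det J = +√2/2`: `−(λ − √2)(λ + √2/2)²`, strain rates
  `(√2, −√2/2, −√2/2)` = the axisymmetric Burgers strain `diag(σ, −σ/2, −σ/2)`, `σ = σ_α = √2`, of `BurgersTubeHeredity`
  / `BurgersColumnarFlowMap`, with ONE expanding direction) and `charpoly_beta_factor` / `jac_charpoly_beta`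
  (`det J = −√2/2`: `−(λ + √2)(λ − √2/2)²`); `unstable_direction_of_alpha`: at a type-α zero
  `w = (1, √2 cos x₀, √2 cos x₂)` satisfies `∇U·w = √2·w` — at `α₀…α₃` this is `(1,1,1), (1,−1,−1), (−1,1,−1), (−1,−1,1)`
  up to sign, the directions `dᵢ` of the four skeleton lines of `ABCSkeletonSeparation`;
* §3 the eight values `jac_det_alpha0…3 = √2/2`, `jac_det_beta0…3 = −√2/2` and `index_sum_eq_zero`: the signed count
  `Σ sign det J` over the eight zeros of a period cell is `0` (the Poincaré–Hopf number `χ(𝕋³) = 0` behind the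
  detector's completeness check — the arithmetic on kernel values; the topology is not formalised).
LABEL: MODEL-door kinematics. WHAT THIS IS NOT: not NS; no flow is evolved.
-/

namespace Summit.NavierStokesRegularity.FluidComputer.ABCStagnationJacobian

open Real Literature.Analysis.FluidPDE ABCStagnationSkeleton

/-! ## §1 The Jacobian of `U = abc 1 1 1` and its invariants at a general point -/

/-- The Jacobian written out (`A = B = C = 1`): row `j` = `∂/∂xⱼ`, column `i` = component. -/
theorem jac_apply (x : EuclideanSpace ℝ (Fin 3)) :
    ABC.jac 1 1 1 x = ![![0, Real.cos (x 0), -Real.sin (x 0)], ![-Real.sin (x 1), 0, Real.cos (x 1)],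
      ![Real.cos (x 2), -Real.sin (x 2), 0]] := by
  simp [ABC.jac]

/-- INCOMPRESSIBILITY: `tr ∇U = 0` everywhere. -/
theorem jac_trace (x : EuclideanSpace ℝ (Fin 3)) : ∑ i : Fin 3, ABC.jac 1 1 1 x i i = 0 := by
  simp [ABC.jac, Fin.sum_univ_three]

/-- THE DETERMINANT: `det ∇U(x) = cos x₀ cos x₁ cos x₂ − sin x₀ sin x₁ sin x₂` at every point. -/
theorem jac_det_eq (x : EuclideanSpace ℝ (Fin 3)) :
    (Matrix.of (ABC.jac 1 1 1 x)).det =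
      Real.cos (x 0) * Real.cos (x 1) * Real.cos (x 2) - Real.sin (x 0) * Real.sin (x 1) * Real.sin (x 2) := by
  rw [Matrix.det_fin_three]
  simp [ABC.jac]
  ring

/-- THE SECOND INVARIANT (sum of the principal `2 × 2` minors): `cos x₀ sin x₁ + sin x₀ cos x₂ + cos x₁ sin x₂`. -/
theorem jac_minors_eq (x : EuclideanSpace ℝ (Fin 3)) :
    (ABC.jac 1 1 1 x 0 0 * ABC.jac 1 1 1 x 1 1 - ABC.jac 1 1 1 x 0 1 * ABC.jac 1 1 1 x 1 0) +
      (ABC.jac 1 1 1 x 0 0 * ABC.jac 1 1 1 x 2 2 - ABC.jac 1 1 1 x 0 2 * ABC.jac 1 1 1 x 2 0) +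
      (ABC.jac 1 1 1 x 1 1 * ABC.jac 1 1 1 x 2 2 - ABC.jac 1 1 1 x 1 2 * ABC.jac 1 1 1 x 2 1) =
      Real.cos (x 0) * Real.sin (x 1) + Real.sin (x 0) * Real.cos (x 2) + Real.cos (x 1) * Real.sin (x 2) := by
  simp [ABC.jac]

/-- THE CHARACTERISTIC POLYNOMIAL at a general point: `det(∇U − λ) = −λ³ − m₂(x)·λ + det ∇U(x)` (no `λ²` term:
`tr ∇U = 0`), with `m₂` the second invariant of `jac_minors_eq`. -/
theorem jac_charpoly (x : EuclideanSpace ℝ (Fin 3)) (lam : ℝ) :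
    (Matrix.of (ABC.jac 1 1 1 x) - lam • (1 : Matrix (Fin 3) (Fin 3) ℝ)).det =
      -lam ^ 3 - (Real.cos (x 0) * Real.sin (x 1) + Real.sin (x 0) * Real.cos (x 2) +
        Real.cos (x 1) * Real.sin (x 2)) * lam +
      (Real.cos (x 0) * Real.cos (x 1) * Real.cos (x 2) - Real.sin (x 0) * Real.sin (x 1) * Real.sin (x 2)) := by
  rw [Matrix.det_fin_three]
  simp [ABC.jac]
  ring

/-! ## §2 The Jacobian at a stagnation point: symmetric, non-degenerate, type by the sign of the sines -/

/-- **PURE STRAIN AT EVERY STAGNATION POINT**: `∇U(x)` is SYMMETRIC wherever `U x = 0` (entries `∂₀U₁ = cos x₀ =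
−sin x₁ = ∂₁U₀` etc. by the stagnation equations). The host is Beltrami (`curl U = U`), so its vorticity — the
antisymmetric part — vanishes exactly where `U` does; this is the entrywise form, for all eight point types at once
(`ABCAlphaPointStrain.jac_alpha0_symm` was the diagonal case). -/
theorem jac_symm_of_abc_eq_zero {x : EuclideanSpace ℝ (Fin 3)} (h : ABC.abc 1 1 1 x = 0) (j i : Fin 3) :
    ABC.jac 1 1 1 x j i = ABC.jac 1 1 1 x i j := by
  obtain ⟨h0, h1, h2⟩ := (abc_eq_zero_iff_eqns x).1 h
  fin_cases j <;> fin_cases i <;> simp [ABC.jac] <;> linarith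

/-- At a stagnation point the Jacobian is the symmetric off-diagonal matrix of COSINES:
`∇U = [[0, c₀, c₂], [c₀, 0, c₁], [c₂, c₁, 0]]`, `cᵢ = cos xᵢ ∈ {±√2/2}`. -/
theorem jac_eq_of_abc_eq_zero {x : EuclideanSpace ℝ (Fin 3)} (h : ABC.abc 1 1 1 x = 0) :
    ABC.jac 1 1 1 x = ![![0, Real.cos (x 0), Real.cos (x 2)], ![Real.cos (x 0), 0, Real.cos (x 1)],
      ![Real.cos (x 2), Real.cos (x 1), 0]] := by
  obtain ⟨h0, h1, h2⟩ := (abc_eq_zero_iff_eqns x).1 h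
  have a0 : Real.sin (x 0) = -Real.cos (x 2) := by linarith
  have a1 : Real.sin (x 1) = -Real.cos (x 0) := by linarith
  have a2 : Real.sin (x 2) = -Real.cos (x 1) := by linarith
  rw [jac_apply, a0, a1, a2]
  simp

/-- `det ∇U = −2 sin x₀ sin x₁ sin x₂` at a stagnation point (`cos x₀ cos x₁ cos x₂ = −sin x₁ sin x₂ sin x₀` there). -/
theorem jac_det_eq_of_abc_eq_zero {x : EuclideanSpace ℝ (Fin 3)} (h : ABC.abc 1 1 1 x = 0) :
    (Matrix.of (ABC.jac 1 1 1 x)).det = -2 * (Real.sin (x 0) * Real.sin (x 1) * Real.sin (x 2)) := by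
  obtain ⟨h0, h1, h2⟩ := (abc_eq_zero_iff_eqns x).1 h
  have b0 : Real.cos (x 0) = -Real.sin (x 1) := by linarith
  have b1 : Real.cos (x 1) = -Real.sin (x 2) := by linarith
  have b2 : Real.cos (x 2) = -Real.sin (x 0) := by linarith
  rw [jac_det_eq, b0, b1, b2]; ring

/-- Equivalently `det ∇U = 2 cos x₀ cos x₁ cos x₂` at a stagnation point. -/
theorem jac_det_eq_cos_of_abc_eq_zero {x : EuclideanSpace ℝ (Fin 3)} (h : ABC.abc 1 1 1 x = 0) :
    (Matrix.of (ABC.jac 1 1 1 x)).det = 2 * (Real.cos (x 0) * Real.cos (x 1) * Real.cos (x 2)) := by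
  obtain ⟨h0, h1, h2⟩ := (abc_eq_zero_iff_eqns x).1 h
  have a0 : Real.sin (x 0) = -Real.cos (x 2) := by linarith
  have a1 : Real.sin (x 1) = -Real.cos (x 0) := by linarith
  have a2 : Real.sin (x 2) = -Real.cos (x 1) := by linarith
  rw [jac_det_eq, a0, a1, a2]; ring

/-- **NON-DEGENERACY OF EVERY STAGNATION POINT**: `(det ∇U)² = ½` wherever `U x = 0` (`4 sin²x₀ sin²x₁ sin²x₂ =
4/8`). So all zeros of the host are hyperbolic-type fixed points of `ẋ = U(x)` with `|det| = √2/2`; by the implicit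
function theorem each persists, displaced by `O(ε)`, under any `C¹`-small perturbation of the field — the kernel half
of the generic-arm prior «8 structurally stable skeleton zeros» (STATUS PRE-DATA NOTE (g2)). -/
theorem jac_det_sq_of_abc_eq_zero {x : EuclideanSpace ℝ (Fin 3)} (h : ABC.abc 1 1 1 x = 0) :
    (Matrix.of (ABC.jac 1 1 1 x)).det ^ 2 = 1 / 2 := by
  have s0 := sin_sq_eq_half_of_abc_eq_zero h 0
  have s1 := sin_sq_eq_half_of_abc_eq_zero h 1
  have s2 := sin_sq_eq_half_of_abc_eq_zero h 2
  rw [jac_det_eq_of_abc_eq_zero h]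
  have e : (-2 * (Real.sin (x 0) * Real.sin (x 1) * Real.sin (x 2))) ^ 2 =
      4 * Real.sin (x 0) ^ 2 * Real.sin (x 1) ^ 2 * Real.sin (x 2) ^ 2 := by ring
  rw [e, s0, s1, s2]; norm_num

/-- Hence `det ∇U ≠ 0` at every stagnation point. -/
theorem jac_det_ne_zero_of_abc_eq_zero {x : EuclideanSpace ℝ (Fin 3)} (h : ABC.abc 1 1 1 x = 0) :
    (Matrix.of (ABC.jac 1 1 1 x)).det ≠ 0 := by
  intro h0
  have := jac_det_sq_of_abc_eq_zero h
  rw [h0] at this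
  norm_num at this

/-- … and in fact `det ∇U = √2/2 ∨ det ∇U = −√2/2`: two TYPES and nothing else. -/
theorem jac_det_eq_or_of_abc_eq_zero {x : EuclideanSpace ℝ (Fin 3)} (h : ABC.abc 1 1 1 x = 0) :
    (Matrix.of (ABC.jac 1 1 1 x)).det = Real.sqrt 2 / 2 ∨ (Matrix.of (ABC.jac 1 1 1 x)).det = -(Real.sqrt 2 / 2) :=
  (sq_eq_half_iff _).1 (jac_det_sq_of_abc_eq_zero h)

/-- THE TYPE RULE: at a stagnation point `det ∇U > 0` (type α, Poincaré–Hopf index `+1`) iff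
`sin x₀ sin x₁ sin x₂ < 0`, i.e. iff an ODD number of the three coordinates lie in `{5π/4, 7π/4} mod 2π`. -/
theorem jac_det_pos_iff_of_abc_eq_zero {x : EuclideanSpace ℝ (Fin 3)} (h : ABC.abc 1 1 1 x = 0) :
    0 < (Matrix.of (ABC.jac 1 1 1 x)).det ↔ Real.sin (x 0) * Real.sin (x 1) * Real.sin (x 2) < 0 := by
  rw [jac_det_eq_of_abc_eq_zero h]
  constructor <;> intro hh <;> linarith

/-- THE SECOND INVARIANT IS `−3/2` AT EVERY STAGNATION POINT (`cos x₀ sin x₁ = −cos²x₀ = −½` and cyclically). -/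
theorem jac_minors_of_abc_eq_zero {x : EuclideanSpace ℝ (Fin 3)} (h : ABC.abc 1 1 1 x = 0) :
    Real.cos (x 0) * Real.sin (x 1) + Real.sin (x 0) * Real.cos (x 2) + Real.cos (x 1) * Real.sin (x 2) = -3 / 2 := by
  obtain ⟨h0, h1, h2⟩ := (abc_eq_zero_iff_eqns x).1 h
  have c0 := cos_sq_eq_half_of_abc_eq_zero h 0
  have s0 := sin_sq_eq_half_of_abc_eq_zero h 0
  have c1 := cos_sq_eq_half_of_abc_eq_zero h 1
  have a1 : Real.sin (x 1) = -Real.cos (x 0) := by linarith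
  have a2 : Real.sin (x 2) = -Real.cos (x 1) := by linarith
  have b2 : Real.cos (x 2) = -Real.sin (x 0) := by linarith
  rw [a1, a2, b2]; linear_combination -c0 - s0 - c1

/-- **THE CHARACTERISTIC POLYNOMIAL AT A STAGNATION POINT**: `det(∇U − λ) = −λ³ + (3/2)λ + det ∇U` with
`det ∇U = ±√2/2`. -/
theorem jac_charpoly_of_abc_eq_zero {x : EuclideanSpace ℝ (Fin 3)} (h : ABC.abc 1 1 1 x = 0) (lam : ℝ) :
    (Matrix.of (ABC.jac 1 1 1 x) - lam • (1 : Matrix (Fin 3) (Fin 3) ℝ)).det =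
      -lam ^ 3 + 3 / 2 * lam + (Matrix.of (ABC.jac 1 1 1 x)).det := by
  rw [jac_charpoly, jac_det_eq, jac_minors_of_abc_eq_zero h]; ring

/-- TYPE α FACTORISATION: `−λ³ + (3/2)λ + √2/2 = −(λ − √2)(λ + √2/2)²` — strain rates `(√2, −√2/2, −√2/2)`: ONE
expanding direction (the rope-carrying line leaves the point at rate `σ_α = √2`) and a CONTRACTING plane at the
axisymmetric rate `−σ_α/2`; exactly the Burgers strain `diag(σ, −σ/2, −σ/2)` of the heredity files
(`BurgersTubeHeredity`, `BurgersColumnarFlowMap`), now at all four α-points, not only at `α₀`. -/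
theorem charpoly_alpha_factor (lam : ℝ) :
    -lam ^ 3 + 3 / 2 * lam + Real.sqrt 2 / 2 = -((lam - Real.sqrt 2) * (lam + Real.sqrt 2 / 2) ^ 2) := by
  have h2 : Real.sqrt 2 ^ 2 = 2 := Real.sq_sqrt (by norm_num)
  linear_combination (-(3 / 4) * lam - Real.sqrt 2 / 4) * h2

/-- TYPE β FACTORISATION: `−λ³ + (3/2)λ − √2/2 = −(λ + √2)(λ − √2/2)²` — rates `(−√2, √2/2, √2/2)`: the line ARRIVES
and the normal plane EXPANDS (the sheet-forming end of each rope-carrying line). -/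
theorem charpoly_beta_factor (lam : ℝ) :
    -lam ^ 3 + 3 / 2 * lam - Real.sqrt 2 / 2 = -((lam + Real.sqrt 2) * (lam - Real.sqrt 2 / 2) ^ 2) := by
  have h2 : Real.sqrt 2 ^ 2 = 2 := Real.sq_sqrt (by norm_num)
  linear_combination (-(3 / 4) * lam + Real.sqrt 2 / 4) * h2

/-- Hence at a type-α zero (`det ∇U = √2/2`) the characteristic polynomial is `−(λ − √2)(λ + √2/2)²`. -/
theorem jac_charpoly_alpha {x : EuclideanSpace ℝ (Fin 3)} (h : ABC.abc 1 1 1 x = 0)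
    (hd : (Matrix.of (ABC.jac 1 1 1 x)).det = Real.sqrt 2 / 2) (lam : ℝ) :
    (Matrix.of (ABC.jac 1 1 1 x) - lam • (1 : Matrix (Fin 3) (Fin 3) ℝ)).det =
      -((lam - Real.sqrt 2) * (lam + Real.sqrt 2 / 2) ^ 2) := by
  rw [jac_charpoly_of_abc_eq_zero h, hd, charpoly_alpha_factor]

/-- … and at a type-β zero (`det ∇U = −√2/2`) it is `−(λ + √2)(λ − √2/2)²`. -/
theorem jac_charpoly_beta {x : EuclideanSpace ℝ (Fin 3)} (h : ABC.abc 1 1 1 x = 0)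
    (hd : (Matrix.of (ABC.jac 1 1 1 x)).det = -(Real.sqrt 2 / 2)) (lam : ℝ) :
    (Matrix.of (ABC.jac 1 1 1 x) - lam • (1 : Matrix (Fin 3) (Fin 3) ℝ)).det =
      -((lam + Real.sqrt 2) * (lam - Real.sqrt 2 / 2) ^ 2) := by
  rw [jac_charpoly_of_abc_eq_zero h, hd, ← charpoly_beta_factor]; ring

/-- THE UNSTABLE DIRECTION AT A TYPE-α ZERO, read off the local cosines: `w = (1, √2 cos x₀, √2 cos x₂)` satisfies
`∇U·w = √2·w` (`(∇U w)ᵢ = Σⱼ wⱼ ∂ⱼUᵢ`). At `α₀…α₃` this gives `w ∝ (1,1,1), (1,−1,−1), (−1,1,−1), (−1,−1,1)` = the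
directions `dᵢ` of the four skeleton lines of `ABCSkeletonSeparation`. -/
theorem unstable_direction_of_alpha {x : EuclideanSpace ℝ (Fin 3)} (h : ABC.abc 1 1 1 x = 0)
    (hd : (Matrix.of (ABC.jac 1 1 1 x)).det = Real.sqrt 2 / 2) (i : Fin 3) :
    ∑ j : Fin 3, (![1, Real.sqrt 2 * Real.cos (x 0), Real.sqrt 2 * Real.cos (x 2)] j) * ABC.jac 1 1 1 x j i =
      Real.sqrt 2 * ![1, Real.sqrt 2 * Real.cos (x 0), Real.sqrt 2 * Real.cos (x 2)] i := by
  have c0 := cos_sq_eq_half_of_abc_eq_zero h 0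
  have c2 := cos_sq_eq_half_of_abc_eq_zero h 2
  have hccc : Real.cos (x 0) * Real.cos (x 1) * Real.cos (x 2) = Real.sqrt 2 / 4 := by
    have := jac_det_eq_cos_of_abc_eq_zero h; rw [hd] at this; linarith
  have h2 : Real.sqrt 2 ^ 2 = 2 := Real.sq_sqrt (by norm_num)
  rw [jac_eq_of_abc_eq_zero h, Fin.sum_univ_three]
  fin_cases i
  · simp
    linear_combination Real.sqrt 2 * c0 + Real.sqrt 2 * c2
  · simp
    -- goal: cos x₀ + √2 cos x₂ · cos x₁ = √2 · (√2 cos x₀); key: √2 cos x₁ cos x₂ = cos x₀ (cancel cos x₀ ≠ 0)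
    have hc0 : Real.cos (x 0) ≠ 0 := by intro z; rw [z] at c0; norm_num at c0
    have k : Real.sqrt 2 * (Real.cos (x 1) * Real.cos (x 2)) = Real.cos (x 0) := by
      have e : Real.cos (x 0) * (Real.sqrt 2 * (Real.cos (x 1) * Real.cos (x 2))) =
          Real.cos (x 0) * Real.cos (x 0) := by
        linear_combination Real.sqrt 2 * hccc + (1 / 4) * h2 - c0
      exact mul_left_cancel₀ hc0 e
    linear_combination k - Real.cos (x 0) * h2
  · simp
    have hc2 : Real.cos (x 2) ≠ 0 := by intro z; rw [z] at c2; norm_num at c2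
    have k : Real.sqrt 2 * (Real.cos (x 0) * Real.cos (x 1)) = Real.cos (x 2) := by
      have e : Real.cos (x 2) * (Real.sqrt 2 * (Real.cos (x 0) * Real.cos (x 1))) =
          Real.cos (x 2) * Real.cos (x 2) := by
        linear_combination Real.sqrt 2 * hccc + (1 / 4) * h2 - c2
      exact mul_left_cancel₀ hc2 e
    linear_combination k - Real.cos (x 2) * h2

/-! ## §3 The eight values: four zeros of index `+1`, four of index `−1`, signed count `0` -/

/-- `2(√2/2)³ = √2/2`. -/
theorem two_mul_sqrt_two_div_two_pow_three : 2 * (Real.sqrt 2 / 2) ^ 3 = Real.sqrt 2 / 2 := by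
  have h2 : Real.sqrt 2 ^ 2 = 2 := Real.sq_sqrt (by norm_num)
  linear_combination (Real.sqrt 2 / 4) * h2

/-- `det ∇U(α₀) = √2/2` (type α, index `+1`). -/
theorem jac_det_alpha0 :
    (Matrix.of (ABC.jac 1 1 1 (!₂[7 * π / 4, 7 * π / 4, 7 * π / 4] : EuclideanSpace ℝ (Fin 3)))).det = Real.sqrt 2 / 2 := by
  rw [jac_det_eq_of_abc_eq_zero ABCAlphaPointStrain.abc_alpha0_eq_zero, ← two_mul_sqrt_two_div_two_pow_three]
  simp [ABCAlphaPointStrain.sin_seven_pi_div_four]; ring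

/-- `det ∇U(α₁) = √2/2`. -/
theorem jac_det_alpha1 :
    (Matrix.of (ABC.jac 1 1 1 (!₂[3 * π / 4, π / 4, 5 * π / 4] : EuclideanSpace ℝ (Fin 3)))).det = Real.sqrt 2 / 2 := by
  rw [jac_det_eq_of_abc_eq_zero abc_alpha1_eq_zero, ← two_mul_sqrt_two_div_two_pow_three]
  simp [ABCAlphaPointStrain.sin_three_pi_div_four, Real.sin_pi_div_four, sin_five_pi_div_four]; ring

/-- `det ∇U(α₂) = √2/2`. -/
theorem jac_det_alpha2 :
    (Matrix.of (ABC.jac 1 1 1 (!₂[5 * π / 4, 3 * π / 4, π / 4] : EuclideanSpace ℝ (Fin 3)))).det = Real.sqrt 2 / 2 := by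
  rw [jac_det_eq_of_abc_eq_zero abc_alpha2_eq_zero, ← two_mul_sqrt_two_div_two_pow_three]
  simp [ABCAlphaPointStrain.sin_three_pi_div_four, Real.sin_pi_div_four, sin_five_pi_div_four]; ring

/-- `det ∇U(α₃) = √2/2`. -/
theorem jac_det_alpha3 :
    (Matrix.of (ABC.jac 1 1 1 (!₂[π / 4, 5 * π / 4, 3 * π / 4] : EuclideanSpace ℝ (Fin 3)))).det = Real.sqrt 2 / 2 := by
  rw [jac_det_eq_of_abc_eq_zero abc_alpha3_eq_zero, ← two_mul_sqrt_two_div_two_pow_three]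
  simp [ABCAlphaPointStrain.sin_three_pi_div_four, Real.sin_pi_div_four, sin_five_pi_div_four]; ring

/-- `det ∇U(β₀) = −√2/2` (type β, index `−1`). -/
theorem jac_det_beta0 :
    (Matrix.of (ABC.jac 1 1 1 (!₂[3 * π / 4, 3 * π / 4, 3 * π / 4] : EuclideanSpace ℝ (Fin 3)))).det = -(Real.sqrt 2 / 2) := by
  rw [jac_det_eq_of_abc_eq_zero ABCAlphaPointStrain.abc_beta0_eq_zero, ← two_mul_sqrt_two_div_two_pow_three]
  simp [ABCAlphaPointStrain.sin_three_pi_div_four]; ring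

/-- `det ∇U(β₁) = −√2/2`. -/
theorem jac_det_beta1 :
    (Matrix.of (ABC.jac 1 1 1 (!₂[7 * π / 4, 5 * π / 4, π / 4] : EuclideanSpace ℝ (Fin 3)))).det = -(Real.sqrt 2 / 2) := by
  rw [jac_det_eq_of_abc_eq_zero abc_beta1_eq_zero, ← two_mul_sqrt_two_div_two_pow_three]
  simp [ABCAlphaPointStrain.sin_seven_pi_div_four, Real.sin_pi_div_four, sin_five_pi_div_four]; ring

/-- `det ∇U(β₂) = −√2/2`. -/
theorem jac_det_beta2 :
    (Matrix.of (ABC.jac 1 1 1 (!₂[π / 4, 7 * π / 4, 5 * π / 4] : EuclideanSpace ℝ (Fin 3)))).det = -(Real.sqrt 2 / 2) := by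
  rw [jac_det_eq_of_abc_eq_zero abc_beta2_eq_zero, ← two_mul_sqrt_two_div_two_pow_three]
  simp [ABCAlphaPointStrain.sin_seven_pi_div_four, Real.sin_pi_div_four, sin_five_pi_div_four]; ring

/-- `det ∇U(β₃) = −√2/2`. -/
theorem jac_det_beta3 :
    (Matrix.of (ABC.jac 1 1 1 (!₂[5 * π / 4, π / 4, 7 * π / 4] : EuclideanSpace ℝ (Fin 3)))).det = -(Real.sqrt 2 / 2) := by
  rw [jac_det_eq_of_abc_eq_zero abc_beta3_eq_zero, ← two_mul_sqrt_two_div_two_pow_three]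
  simp [ABCAlphaPointStrain.sin_seven_pi_div_four, Real.sin_pi_div_four, sin_five_pi_div_four]; ring

/-- THE SIGNED COUNT PER CELL IS ZERO: `Σ sign det ∇U` over the eight stagnation points of one period cell is
`4·(+1) + 4·(−1) = 0` — the Poincaré–Hopf count `χ(𝕋³) = 0` that the site detector prints as its completeness
check `#α − #β = 0` (the topology itself is not formalised; this is the arithmetic on the eight kernel values). -/
theorem index_sum_eq_zero :
    Real.sign (Matrix.of (ABC.jac 1 1 1 (!₂[7 * π / 4, 7 * π / 4, 7 * π / 4] : EuclideanSpace ℝ (Fin 3)))).det +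
    Real.sign (Matrix.of (ABC.jac 1 1 1 (!₂[3 * π / 4, π / 4, 5 * π / 4] : EuclideanSpace ℝ (Fin 3)))).det +
    Real.sign (Matrix.of (ABC.jac 1 1 1 (!₂[5 * π / 4, 3 * π / 4, π / 4] : EuclideanSpace ℝ (Fin 3)))).det +
    Real.sign (Matrix.of (ABC.jac 1 1 1 (!₂[π / 4, 5 * π / 4, 3 * π / 4] : EuclideanSpace ℝ (Fin 3)))).det +
    Real.sign (Matrix.of (ABC.jac 1 1 1 (!₂[3 * π / 4, 3 * π / 4, 3 * π / 4] : EuclideanSpace ℝ (Fin 3)))).det +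
    Real.sign (Matrix.of (ABC.jac 1 1 1 (!₂[7 * π / 4, 5 * π / 4, π / 4] : EuclideanSpace ℝ (Fin 3)))).det +
    Real.sign (Matrix.of (ABC.jac 1 1 1 (!₂[π / 4, 7 * π / 4, 5 * π / 4] : EuclideanSpace ℝ (Fin 3)))).det +
    Real.sign (Matrix.of (ABC.jac 1 1 1 (!₂[5 * π / 4, π / 4, 7 * π / 4] : EuclideanSpace ℝ (Fin 3)))).det = 0 := by
  have hp : 0 < Real.sqrt 2 / 2 := by positivity
  have hn : -(Real.sqrt 2 / 2) < 0 := by linarith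
  rw [jac_det_alpha0, jac_det_alpha1, jac_det_alpha2, jac_det_alpha3, jac_det_beta0, jac_det_beta1, jac_det_beta2,
    jac_det_beta3, Real.sign_of_pos hp, Real.sign_of_neg hn]
  norm_num

end Summit.NavierStokesRegularity.FluidComputer.ABCStagnationJacobian
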